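import Literature.Geometry.Lorentzian.LinearChargeConservation
import Mathlib.Analysis.Calculus.FDeriv.Symmetric
import HarnessLib

/-!
# The conic Bogovskiĭ kernel of Mao–Oh–Tao away from the origin

(trunk G08 = T-LORENTZ; family `gr`; namespace `Literature.Geometry.Lorentzian.MaoOhTao`.)

Mao–Oh–Tao (arXiv:2308.13031), Lemma 2.5 inverts the double divergence `h ↦ ∂_i∂_j h^{ij}`
(the linearised Hamiltonian constraint operator at the flat metric, `LinearChargeConservation.lean`,
`CoordFlatBackground.lean`) on a cone `C_ω` by convolution with the kernel

  `K^{ij}_κ(z) = κ(z/|z|) zⁱ zʲ / |z|³`,   `κ ∈ C^∞(𝕊²)`, `∫ κ = 1`, `supp κ ⊆ ω`,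

and Remark 2.6 checks `(S_c2)`, `∂_i∂_j (S_c f)^{ij} = f`, by the computation

  `∂_i∂_j (κ zⁱzʲ/|z|³) = ∂_i(∂_jκ · zⁱzʲ/|z|³ + κ ∂_j(zⁱzʲ/|z|³)) = ∂_i(κ zⁱ/|z|³) = δ₀`.

This file proves the pointwise part of that computation on `ℝ³ ∖ {0}`, in the coordinate
vocabulary `pd`, `e` of the annular gluing fact (`ObstructionFreeGluing.lean`), for a kernel
profile `κ : E3 → ℝ` that is differentiable and `0`-homogeneous off the origin (the paper's
`κ(z/|z|)`, `comp_normalize_smul`, `differentiableAt_comp_normalize`):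

* `pd_inv_norm_cube`, `sum_pd_coord_mul_inv_norm_cube` (`div (z/|z|³) = 0`),
  `sum_pd_coord_coord_inv_norm_cube` (`Σ_j ∂_j (zⁱzʲ/|z|³) = zⁱ/|z|³`) — the Newtonian monomials;
* `fderiv_apply_self_eq_zero_of_homogeneous`, `sum_coord_mul_pd_eq_zero_of_homogeneous` — Euler's
  relation `z · ∇κ = 0` for a `0`-homogeneous `κ`;
* `sum_pd_conicKernel` — `Σ_j ∂_j K^{ij}_κ = κ zⁱ/|z|³` (the middle step);
* `sum_pd_mul_coord_inv_norm_cube` — `Σ_i ∂_i (κ zⁱ/|z|³) = 0` off the origin (the last step);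
* `sum_pd_sum_pd_conicKernel`, `sum_pd_sum_pd_conicKernel_normalize` — **`∂_i∂_j K^{ij}_κ = 0` on
  `ℝ³ ∖ {0}`**: the double divergence of the conic Bogovskiĭ kernel is supported at the origin.

* `integral_kernel_mul_eq_zero_of_not_mem_cone`, `support_integral_kernel_mul_subset` — **(S_c1)**: the
  convolution of a density supported in a convex cone `C` with a kernel supported in `C` is supported
  in `C` (one scalar component; "obvious from the definition and convexity of the cone");
* `sum_pd_conicKernelT` — the kernel `(K_κ)^{ij}_k = ∂_m(κ (zⁱδ^j_k z^m + δ^i_k zʲz^m − zⁱzʲδ^m_k)/|z|³)`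
  of the operator `T_c` in first-order form, and `sum_pd_conicKernelT_div` — **`Σ_i ∂_i (K_κ)^{ij}_k = 0`
  on `ℝ³ ∖ {0}`** (Lemma 2.5 (T_c2) away from the origin; mixed partials of the `C²` monomials commute).

The distributional identities at the origin (`= δ₀`, `= δ^j_k δ₀`) and the weighted Sobolev bounds
`(S_c3)`, `(T_c3)` are not treated here. Everything is proved; no definitions, no named facts.

## References

* Y. Mao, S.-J. Oh, T. Tao, *Initial data gluing in the asymptotically flat regime via solution
  operators with prescribed support properties*, arXiv:2308.13031 (2023), Lemma 2.5 and
  Remark 2.6 (key `MaoOhTao2023`).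
* M. E. Bogovskiĭ, *Solution of the first boundary value problem for an equation of continuity of
  an incompressible medium*, Dokl. Akad. Nauk SSSR 248 (1979) (the classical divergence case).
-/

noncomputable section

open scoped RealInnerProductSpace Topology ContDiff
open Filter MeasureTheory

namespace Literature.Geometry.Lorentzian

namespace MaoOhTao

variable {x : E3} {m : Fin 3}

/-- `⟪x, e_m⟫ = x_m` for the coordinate frame (a private copy of a FluidPDE helper). [folklore] -/
private theorem inner_e_right (x : E3) (m : Fin 3) : ⟪x, e m⟫ = x m := by
  simp [e, EuclideanSpace.inner_single_right]

/-- `∂_m |y| = y_m/|y|` off the origin. [folklore] -/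
theorem pd_norm (hx : x ≠ 0) : pd m (fun y : E3 ↦ ‖y‖) x = x m / ‖x‖ := by
  rw [pd, (hasFDerivAt_norm_E3 hx).fderiv]
  simp [inner_e_right, div_eq_inv_mul]

/-- The Euclidean norm is differentiable off the origin. [folklore] -/
theorem differentiableAt_norm_E3 (hx : x ≠ 0) : DifferentiableAt ℝ (fun y : E3 ↦ ‖y‖) x :=
  (hasFDerivAt_norm_E3 hx).differentiableAt

/-- `∂_m |y|⁻³ = −3 y_m/|y|⁵` off the origin. [folklore] -/
theorem pd_inv_norm_cube (hx : x ≠ 0) :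
    pd m (fun y : E3 ↦ (‖y‖ ^ 3)⁻¹) x = -3 * x m / ‖x‖ ^ 5 := by
  have hn : ‖x‖ ≠ 0 := norm_ne_zero_iff.2 hx
  have hg : HasDerivAt (fun r : ℝ ↦ (r ^ 3)⁻¹) (-(((3 : ℕ) : ℝ) * ‖x‖ ^ (3 - 1)) / (‖x‖ ^ 3) ^ 2) ‖x‖ :=
    (hasDerivAt_pow 3 ‖x‖).fun_inv (pow_ne_zero 3 hn)
  have h : HasFDerivAt (fun y : E3 ↦ (‖y‖ ^ 3)⁻¹)
      ((-(((3 : ℕ) : ℝ) * ‖x‖ ^ (3 - 1)) / (‖x‖ ^ 3) ^ 2) • (‖x‖⁻¹ • (innerSL ℝ x : E3 →L[ℝ] ℝ))) x :=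
    hg.comp_hasFDerivAt x (hasFDerivAt_norm_E3 hx)
  rw [pd, h.fderiv]
  simp only [_root_.smul_apply, smul_eq_mul, innerSL_apply_apply, inner_e_right, Nat.cast_ofNat]
  field_simp

/-- `|y|⁻³` is differentiable off the origin. [folklore] -/
theorem differentiableAt_inv_norm_cube (hx : x ≠ 0) :
    DifferentiableAt ℝ (fun y : E3 ↦ (‖y‖ ^ 3)⁻¹) x :=
  ((differentiableAt_norm_E3 hx).pow 3).fun_inv (pow_ne_zero 3 (norm_ne_zero_iff.2 hx))

/-- `|x|² = Σ_i x_i²` on `E3` (a private copy of a FluidPDE helper). [folklore] -/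
private theorem norm_sq_eq_sum (x : E3) : ‖x‖ ^ 2 = ∑ i, x i ^ 2 := by
  rw [EuclideanSpace.norm_eq, Real.sq_sqrt (Finset.sum_nonneg fun i _ ↦ by positivity)]
  simp [Real.norm_eq_abs, sq_abs]

/-- **`div (z/|z|³) = 0` off the origin**: the Newtonian field is divergence free (`3/|z|³ − 3|z|²/|z|⁵ = 0`).
[cite: MaoOhTao2023, Remark 2.6] -/
theorem sum_pd_coord_mul_inv_norm_cube (hx : x ≠ 0) :
    ∑ i, pd i (fun y : E3 ↦ y i * (‖y‖ ^ 3)⁻¹) x = 0 := by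
  have hn : ‖x‖ ≠ 0 := norm_ne_zero_iff.2 hx
  have h : ∀ i, pd i (fun y : E3 ↦ y i * (‖y‖ ^ 3)⁻¹) x =
      (‖x‖ ^ 3)⁻¹ + x i * (-3 * x i / ‖x‖ ^ 5) := fun i ↦ by
    rw [pd_coord_mul i (differentiableAt_inv_norm_cube hx), pd_inv_norm_cube hx]
    simp
  simp only [h, Finset.sum_add_distrib, Finset.sum_const, Finset.card_univ, Fintype.card_fin,
    nsmul_eq_mul, Nat.cast_ofNat]
  have h2 : ∑ i, x i * (-3 * x i / ‖x‖ ^ 5) = -3 * (∑ i, x i ^ 2) / ‖x‖ ^ 5 := by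
    rw [Finset.mul_sum, Finset.sum_div]
    exact Finset.sum_congr rfl fun i _ ↦ by ring
  rw [h2, ← norm_sq_eq_sum]
  field_simp
  ring

/-- **`Σ_j ∂_j (zⁱ zʲ/|z|³) = zⁱ/|z|³` off the origin** (`(1 + 3 − 3) zⁱ/|z|³`). [cite: MaoOhTao2023, Remark 2.6] -/
theorem sum_pd_coord_coord_inv_norm_cube (hx : x ≠ 0) (i : Fin 3) :
    ∑ j, pd j (fun y : E3 ↦ y i * (y j * (‖y‖ ^ 3)⁻¹)) x = x i * (‖x‖ ^ 3)⁻¹ := by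
  have hn : ‖x‖ ≠ 0 := norm_ne_zero_iff.2 hx
  have hd : ∀ j, DifferentiableAt ℝ (fun y : E3 ↦ y j * (‖y‖ ^ 3)⁻¹) x := fun j ↦
    ((EuclideanSpace.proj (𝕜 := ℝ) j).differentiableAt).mul (differentiableAt_inv_norm_cube hx)
  have h : ∀ j, pd j (fun y : E3 ↦ y i * (y j * (‖y‖ ^ 3)⁻¹)) x =
      (if i = j then 1 else 0) * (x j * (‖x‖ ^ 3)⁻¹)
        + x i * ((‖x‖ ^ 3)⁻¹ + x j * (-3 * x j / ‖x‖ ^ 5)) := fun j ↦ by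
    rw [pd_coord_mul i (hd j), pd_coord_mul j (differentiableAt_inv_norm_cube hx),
      pd_inv_norm_cube hx]
    simp
  simp only [h, Finset.sum_add_distrib, ite_mul, one_mul, zero_mul, Finset.sum_ite_eq,
    Finset.mem_univ, if_true, ← Finset.mul_sum, Finset.sum_const, Finset.card_univ,
    Fintype.card_fin, nsmul_eq_mul, Nat.cast_ofNat]
  have h2 : ∑ j, x j * (-3 * x j / ‖x‖ ^ 5) = -3 * (∑ j, x j ^ 2) / ‖x‖ ^ 5 := by
    rw [Finset.mul_sum, Finset.sum_div]
    exact Finset.sum_congr rfl fun j _ ↦ by ring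
  rw [h2, ← norm_sq_eq_sum]
  field_simp
  ring

/-- **Euler's relation for a `0`-homogeneous function**: if `κ(t z) = κ(z)` for `t > 0` and `κ` is differentiable at `z`,
then `Dκ(z) z = 0` (`t ↦ κ(t z)` is constant near `1` and has derivative `Dκ(z) z` there). [folklore] -/
theorem fderiv_apply_self_eq_zero_of_homogeneous {κ : E3 → ℝ} (hκ : DifferentiableAt ℝ κ x)
    (hhom : ∀ t : ℝ, 0 < t → κ (t • x) = κ x) : fderiv ℝ κ x x = 0 := by
  have hline : HasDerivAt (fun t : ℝ ↦ t • x) x 1 := by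
    simpa using (hasDerivAt_id (1 : ℝ)).smul_const x
  have hcomp : HasDerivAt (fun t : ℝ ↦ κ (t • x)) (fderiv ℝ κ x x) 1 := by
    have h1 : HasFDerivAt κ (fderiv ℝ κ x) ((1 : ℝ) • x) := by
      rw [one_smul]; exact hκ.hasFDerivAt
    exact h1.comp_hasDerivAt 1 hline
  have hconst : (fun t : ℝ ↦ κ (t • x)) =ᶠ[𝓝 1] fun _ ↦ κ x :=
    (eventually_gt_nhds one_pos).mono fun t ht ↦ hhom t ht
  have h0 : HasDerivAt (fun t : ℝ ↦ κ (t • x)) 0 1 :=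
    (hasDerivAt_const (1 : ℝ) (κ x)).congr_of_eventuallyEq hconst
  exact hcomp.unique h0

/-- Euler's relation in coordinates: `Σ_j z_j ∂_j κ(z) = 0` for a `0`-homogeneous `κ`. [folklore] -/
theorem sum_coord_mul_pd_eq_zero_of_homogeneous {κ : E3 → ℝ} (hκ : DifferentiableAt ℝ κ x)
    (hhom : ∀ t : ℝ, 0 < t → κ (t • x) = κ x) : ∑ j, x j * pd j κ x = 0 := by
  have hx : x = ∑ j, x j • e j := by
    simpa [e] using ((EuclideanSpace.basisFun (Fin 3) ℝ).sum_repr x).symm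
  have key : fderiv ℝ κ x (∑ j, x j • e j) = 0 := by
    rw [← hx]
    exact fderiv_apply_self_eq_zero_of_homogeneous hκ hhom
  rw [map_sum] at key
  simpa only [map_smul, smul_eq_mul, pd] using key


/-! ### The conic Bogovskiĭ kernel `K^{ij}_κ(z) = κ(z) zⁱ zʲ / |z|³` away from the origin -/

variable {κ : E3 → ℝ}

/-- The monomials `zⁱ zʲ/|z|³` are differentiable off the origin. [folklore] -/
theorem differentiableAt_coord_coord_inv_norm_cube (hx : x ≠ 0) (i j : Fin 3) :
    DifferentiableAt ℝ (fun y : E3 ↦ y i * (y j * (‖y‖ ^ 3)⁻¹)) x :=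
  (EuclideanSpace.proj (𝕜 := ℝ) i).differentiableAt.mul
    ((EuclideanSpace.proj (𝕜 := ℝ) j).differentiableAt.mul (differentiableAt_inv_norm_cube hx))

/-- **`Σ_j ∂_j K^{ij}_κ = κ zⁱ/|z|³` off the origin** for the conic Bogovskiĭ kernel `K^{ij}_κ = κ zⁱzʲ/|z|³` with `κ`
differentiable and `0`-homogeneous at `z` (Remark 2.6, middle step: the term `∂_jκ · zⁱzʲ/|z|³` vanishes by Euler's
relation). [cite: MaoOhTao2023, Remark 2.6] -/
theorem sum_pd_conicKernel (hx : x ≠ 0) (hκ : DifferentiableAt ℝ κ x)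
    (hhom : ∀ t : ℝ, 0 < t → κ (t • x) = κ x) (i : Fin 3) :
    ∑ j, pd j (fun y : E3 ↦ κ y * (y i * (y j * (‖y‖ ^ 3)⁻¹))) x = κ x * (x i * (‖x‖ ^ 3)⁻¹) := by
  have h : ∀ j, pd j (fun y : E3 ↦ κ y * (y i * (y j * (‖y‖ ^ 3)⁻¹))) x =
      (x i * (‖x‖ ^ 3)⁻¹) * (x j * pd j κ x)
        + κ x * pd j (fun y : E3 ↦ y i * (y j * (‖y‖ ^ 3)⁻¹)) x := fun j ↦ by
    rw [pd_mul hκ (differentiableAt_coord_coord_inv_norm_cube hx i j)]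
    ring
  simp only [h, Finset.sum_add_distrib, ← Finset.mul_sum, sum_coord_mul_pd_eq_zero_of_homogeneous hκ hhom,
    mul_zero, zero_add, sum_pd_coord_coord_inv_norm_cube hx i]

/-- **`Σ_i ∂_i (κ zⁱ/|z|³) = 0` off the origin** (Remark 2.6, last step: Euler's relation and `div (z/|z|³) = 0`; at the
origin this divergence is `δ₀`). [cite: MaoOhTao2023, Remark 2.6] -/
theorem sum_pd_mul_coord_inv_norm_cube (hx : x ≠ 0) (hκ : DifferentiableAt ℝ κ x)
    (hhom : ∀ t : ℝ, 0 < t → κ (t • x) = κ x) :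
    ∑ i, pd i (fun y : E3 ↦ κ y * (y i * (‖y‖ ^ 3)⁻¹)) x = 0 := by
  have hd : ∀ i, DifferentiableAt ℝ (fun y : E3 ↦ y i * (‖y‖ ^ 3)⁻¹) x := fun i ↦
    (EuclideanSpace.proj (𝕜 := ℝ) i).differentiableAt.mul (differentiableAt_inv_norm_cube hx)
  have h : ∀ i, pd i (fun y : E3 ↦ κ y * (y i * (‖y‖ ^ 3)⁻¹)) x =
      (‖x‖ ^ 3)⁻¹ * (x i * pd i κ x) + κ x * pd i (fun y : E3 ↦ y i * (‖y‖ ^ 3)⁻¹) x := fun i ↦ by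
    rw [pd_mul hκ (hd i)]
    ring
  simp only [h, Finset.sum_add_distrib, ← Finset.mul_sum, sum_coord_mul_pd_eq_zero_of_homogeneous hκ hhom,
    mul_zero, zero_add, sum_pd_coord_mul_inv_norm_cube hx]

/-- **`∂_i ∂_j K^{ij}_κ = 0` on `ℝ³ ∖ {0}`**: the double divergence of the conic Bogovskiĭ kernel is supported at the
origin (where it is `δ₀`, Remark 2.6), for `κ` differentiable and `0`-homogeneous off the origin; the inner divergence is
taken first, as in the printed computation (`sum_pd_conicKernel` holds on a neighbourhood, `Filter.EventuallyEq.fderiv_eq`,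
then `sum_pd_mul_coord_inv_norm_cube`). [cite: MaoOhTao2023, Lemma 2.5 (S_c2) and Remark 2.6] -/
theorem sum_pd_sum_pd_conicKernel (hx : x ≠ 0) (hκ : ∀ y : E3, y ≠ 0 → DifferentiableAt ℝ κ y)
    (hhom : ∀ y : E3, y ≠ 0 → ∀ t : ℝ, 0 < t → κ (t • y) = κ y) :
    ∑ i, pd i (fun y : E3 ↦ ∑ j, pd j (fun z : E3 ↦ κ z * (z i * (z j * (‖z‖ ^ 3)⁻¹))) y) x = 0 := by
  have hne : ∀ᶠ y in 𝓝 x, y ≠ 0 := isOpen_ne.mem_nhds hx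
  have heq : ∀ i, (fun y : E3 ↦ ∑ j, pd j (fun z : E3 ↦ κ z * (z i * (z j * (‖z‖ ^ 3)⁻¹))) y)
      =ᶠ[𝓝 x] fun y ↦ κ y * (y i * (‖y‖ ^ 3)⁻¹) := fun i ↦
    hne.mono fun y hy ↦ sum_pd_conicKernel hy (hκ y hy) (hhom y hy) i
  have h : ∀ i, pd i (fun y : E3 ↦ ∑ j, pd j (fun z : E3 ↦ κ z * (z i * (z j * (‖z‖ ^ 3)⁻¹))) y) x =
      pd i (fun y : E3 ↦ κ y * (y i * (‖y‖ ^ 3)⁻¹)) x := fun i ↦ by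
    rw [pd, pd, (heq i).fderiv_eq]
  simp only [h, sum_pd_mul_coord_inv_norm_cube hx (hκ x hx) (hhom x hx)]


/-! ### The paper's form `κ(z) = κ₀(z/|z|)` -/

/-- The paper's profile `z ↦ κ₀(z/|z|)` is `0`-homogeneous off the origin. [cite: MaoOhTao2023, Lemma 2.5] -/
theorem comp_normalize_smul (κ₀ : E3 → ℝ) {y : E3} (hy : y ≠ 0) {t : ℝ} (ht : 0 < t) :
    κ₀ (‖t • y‖⁻¹ • (t • y)) = κ₀ (‖y‖⁻¹ • y) := by
  congr 1
  rw [norm_smul, Real.norm_eq_abs, abs_of_pos ht, smul_smul]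
  congr 1
  field_simp

/-- `z ↦ κ₀(z/|z|)` is differentiable off the origin wherever `κ₀` is differentiable at `z/|z|`. [folklore] -/
theorem differentiableAt_comp_normalize {κ₀ : E3 → ℝ} {y : E3} (hy : y ≠ 0)
    (hκ₀ : DifferentiableAt ℝ κ₀ (‖y‖⁻¹ • y)) :
    DifferentiableAt ℝ (fun z : E3 ↦ κ₀ (‖z‖⁻¹ • z)) y := by
  have hg : DifferentiableAt ℝ (fun z : E3 ↦ ‖z‖⁻¹ • z) y :=
    ((differentiableAt_norm_E3 hy).fun_inv (norm_ne_zero_iff.2 hy)).fun_smul differentiableAt_id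
  exact DifferentiableAt.comp (f := fun z : E3 ↦ ‖z‖⁻¹ • z) y hκ₀ hg

/-- **Remark 2.6 for the kernel of Lemma 2.5**: for a differentiable profile `κ₀` (on `ℝ³`; only its values near the unit
sphere enter), the kernel `K^{ij}(z) = κ₀(z/|z|) zⁱ zʲ/|z|³` of the conic solution operator `S_c` satisfies
`∂_i ∂_j K^{ij} = 0` on `ℝ³ ∖ {0}`. [cite: MaoOhTao2023, Lemma 2.5 (S_c2) and Remark 2.6] -/
theorem sum_pd_sum_pd_conicKernel_normalize {κ₀ : E3 → ℝ} (hκ₀ : Differentiable ℝ κ₀) (hx : x ≠ 0) :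
    ∑ i, pd i (fun y : E3 ↦ ∑ j,
      pd j (fun z : E3 ↦ κ₀ (‖z‖⁻¹ • z) * (z i * (z j * (‖z‖ ^ 3)⁻¹))) y) x = 0 :=
  sum_pd_sum_pd_conicKernel hx (fun _ hy ↦ differentiableAt_comp_normalize hy (hκ₀ _))
    (fun _ hy _ ht ↦ comp_normalize_smul κ₀ hy ht)

/-! ### (S_c1): cone support of the convolution -/

/-- The integrand of the convolution of two functions supported in an additively closed set `C` vanishes identically
off `C`: `f(y) ≠ 0` and `K(x − y) ≠ 0` force `y, x − y ∈ C`, hence `x ∈ C`. [cite: MaoOhTao2023, Remark 2.6] -/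
theorem kernel_mul_eq_zero_of_not_mem_cone {C : Set E3} (hC : ∀ a ∈ C, ∀ b ∈ C, a + b ∈ C)
    {K f : E3 → ℝ} (hK : ∀ z, K z ≠ 0 → z ∈ C) (hf : ∀ y, f y ≠ 0 → y ∈ C) {x : E3} (hx : x ∉ C)
    (y : E3) : K (x - y) * f y = 0 := by
  by_contra h
  rcases mul_ne_zero_iff.1 h with ⟨h1, h2⟩
  exact hx (by simpa using hC (x - y) (hK _ h1) y (hf _ h2))

/-- **(S_c1): cone support of the conic solution operator.** If the kernel `K` and the density `f` are supported in a
convex cone `C` (closed under addition), then `(S_c f)(x) = ∫ K(x − y) f(y) dy = 0` for `x ∉ C` (Mao–Oh–Tao, Lemma 2.5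
(S_c1) and Remark 2.6: "obvious from the definition and convexity of the cone"; here for one scalar component, the
kernels `K^{ij}_κ` being supported in the cone of `supp κ`, `mul_ne_zero_mem_cone`). [cite: MaoOhTao2023, Lemma 2.5 (S_c1)] -/
theorem integral_kernel_mul_eq_zero_of_not_mem_cone {C : Set E3} (hC : ∀ a ∈ C, ∀ b ∈ C, a + b ∈ C)
    {K f : E3 → ℝ} (hK : ∀ z, K z ≠ 0 → z ∈ C) (hf : ∀ y, f y ≠ 0 → y ∈ C) {x : E3} (hx : x ∉ C) :
    ∫ y, K (x - y) * f y = 0 := by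
  simp [kernel_mul_eq_zero_of_not_mem_cone hC hK hf hx]

/-- Support form of (S_c1): `supp (S_c f) ⊆ C`. [cite: MaoOhTao2023, Lemma 2.5 (S_c1)] -/
theorem support_integral_kernel_mul_subset {C : Set E3} (hC : ∀ a ∈ C, ∀ b ∈ C, a + b ∈ C)
    {K f : E3 → ℝ} (hK : ∀ z, K z ≠ 0 → z ∈ C) (hf : ∀ y, f y ≠ 0 → y ∈ C) :
    Function.support (fun x ↦ ∫ y, K (x - y) * f y) ⊆ C := by
  intro x hx
  by_contra hxC
  exact hx (integral_kernel_mul_eq_zero_of_not_mem_cone hC hK hf hxC)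

/-- The kernels `κ(z) · m(z)` (all `K^{ij}_κ`, `(K_κ)^{ij}_k`) are supported in the cone of `κ`. [cite: MaoOhTao2023, Lemma 2.5] -/
theorem mul_ne_zero_mem_cone {C : Set E3} {κ m : E3 → ℝ} (hκ : ∀ z, κ z ≠ 0 → z ∈ C) (z : E3)
    (h : κ z * m z ≠ 0) : z ∈ C :=
  hκ z (left_ne_zero_of_mul h)

/-! ### The kernel `(K_κ)^{ij}_k` of the conic operator `T_c` away from the origin -/

section TKernel

variable {x : E3}

/-- `|y|⁻³` is smooth off the origin. [folklore] -/
theorem contDiffAt_inv_norm_cube {n : ℕ∞ω} (hx : x ≠ 0) :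
    ContDiffAt ℝ n (fun y : E3 ↦ (‖y‖ ^ 3)⁻¹) x :=
  ((contDiffAt_norm ℝ hx).pow 3).inv (pow_ne_zero 3 (norm_ne_zero_iff.2 hx))

/-- The monomial kernels `κ zᵃ zᵇ/|z|³` are as smooth as `κ` off the origin. [folklore] -/
theorem contDiffAt_conicMonomial {n : ℕ∞ω} {κ : E3 → ℝ} (hκ : ContDiffAt ℝ n κ x) (hx : x ≠ 0)
    (a b : Fin 3) : ContDiffAt ℝ n (fun y : E3 ↦ κ y * (y a * (y b * (‖y‖ ^ 3)⁻¹))) x :=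
  hκ.mul ((EuclideanSpace.proj (𝕜 := ℝ) a).contDiff.contDiffAt.mul
    ((EuclideanSpace.proj (𝕜 := ℝ) b).contDiff.contDiffAt.mul (contDiffAt_inv_norm_cube hx)))

/-- Second partials through the second Fréchet derivative: `∂_i ∂_k F (x) = D²F(x)(e_i)(e_k)`. [folklore] -/
theorem pd_pd_eq_fderiv_fderiv {F : E3 → ℝ} (hF : DifferentiableAt ℝ (fderiv ℝ F) x) (i k : Fin 3) :
    pd i (pd k F) x = fderiv ℝ (fderiv ℝ F) x (e i) (e k) := by
  have h : (pd k F) = fun y ↦ fderiv ℝ F y (e k) := rfl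
  rw [pd, h, fderiv_clm_apply hF (differentiableAt_const _)]
  simp [fderiv_fun_const]

/-- **Mixed partials of a `C²` function commute** (`ContDiffAt.isSymmSndFDerivAt`). [folklore] -/
theorem pd_pd_comm {F : E3 → ℝ} (hF : ContDiffAt ℝ 2 F x) (i k : Fin 3) :
    pd i (pd k F) x = pd k (pd i F) x := by
  have hd : DifferentiableAt ℝ (fderiv ℝ F) x :=
    (hF.fderiv_right (m := 1) le_rfl).differentiableAt one_ne_zero
  rw [pd_pd_eq_fderiv_fderiv hd, pd_pd_eq_fderiv_fderiv hd]
  exact (hF.isSymmSndFDerivAt (by simp)).eq (e i) (e k)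

/-- The partials of a `C²` function are differentiable. [folklore] -/
theorem differentiableAt_pd {F : E3 → ℝ} (hF : ContDiffAt ℝ 2 F x) (k : Fin 3) :
    DifferentiableAt ℝ (pd k F) x := by
  have hd : DifferentiableAt ℝ (fderiv ℝ F) x :=
    (hF.fderiv_right (m := 1) le_rfl).differentiableAt one_ne_zero
  exact hd.clm_apply (differentiableAt_const _)

/-- An `if P then f else 0` with a constant condition is differentiable where `f` is. [folklore] -/
theorem differentiableAt_ite (P : Prop) [Decidable P] {f : E3 → ℝ} (hf : DifferentiableAt ℝ f x) :
    DifferentiableAt ℝ (fun y ↦ if P then f y else 0) x := by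
  by_cases h : P
  · simp only [h, if_true]; exact hf
  · simp only [h, if_false]; exact differentiableAt_const _

variable {κ : E3 → ℝ}

/-- **The kernel of `T_c` in first-order form**: for `κ` differentiable and `0`-homogeneous at `z ≠ 0`,
`(K_κ)^{ij}_k(z) = Σ_m ∂_m[κ (zⁱ δ^j_k z^m + δ^i_k zʲ z^m − zⁱ zʲ δ^m_k)/|z|³]`
`  = δ^j_k κ zⁱ/|z|³ + δ^i_k κ zʲ/|z|³ − ∂_k (κ zⁱzʲ/|z|³)`
(the `δ`'s written as `if … then … else 0`; two applications of `sum_pd_conicKernel`). [cite: MaoOhTao2023, Lemma 2.5] -/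
theorem sum_pd_conicKernelT (hx : x ≠ 0) (hκ : DifferentiableAt ℝ κ x)
    (hhom : ∀ t : ℝ, 0 < t → κ (t • x) = κ x) (i j k : Fin 3) :
    ∑ m, pd m (fun z : E3 ↦
        (if j = k then κ z * (z i * (z m * (‖z‖ ^ 3)⁻¹)) else 0)
          + (if i = k then κ z * (z j * (z m * (‖z‖ ^ 3)⁻¹)) else 0)
          - (if m = k then κ z * (z j * (z i * (‖z‖ ^ 3)⁻¹)) else 0)) x =
      (if j = k then κ x * (x i * (‖x‖ ^ 3)⁻¹) else 0)
        + (if i = k then κ x * (x j * (‖x‖ ^ 3)⁻¹) else 0)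
        - pd k (fun z : E3 ↦ κ z * (z j * (z i * (‖z‖ ^ 3)⁻¹))) x := by
  have hd : ∀ a b, DifferentiableAt ℝ (fun z : E3 ↦ κ z * (z a * (z b * (‖z‖ ^ 3)⁻¹))) x := fun a b ↦
    hκ.mul (differentiableAt_coord_coord_inv_norm_cube hx a b)
  have h : ∀ m, pd m (fun z : E3 ↦
        (if j = k then κ z * (z i * (z m * (‖z‖ ^ 3)⁻¹)) else 0)
          + (if i = k then κ z * (z j * (z m * (‖z‖ ^ 3)⁻¹)) else 0)
          - (if m = k then κ z * (z j * (z i * (‖z‖ ^ 3)⁻¹)) else 0)) x =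
      (if j = k then pd m (fun z : E3 ↦ κ z * (z i * (z m * (‖z‖ ^ 3)⁻¹))) x else 0)
        + (if i = k then pd m (fun z : E3 ↦ κ z * (z j * (z m * (‖z‖ ^ 3)⁻¹))) x else 0)
        - (if m = k then pd m (fun z : E3 ↦ κ z * (z j * (z i * (‖z‖ ^ 3)⁻¹))) x else 0) := by
    intro m
    have h12 : DifferentiableAt ℝ (fun z : E3 ↦
        (if j = k then κ z * (z i * (z m * (‖z‖ ^ 3)⁻¹)) else 0)
          + (if i = k then κ z * (z j * (z m * (‖z‖ ^ 3)⁻¹)) else 0)) x :=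
      (differentiableAt_ite _ (hd i m)).add (differentiableAt_ite _ (hd j m))
    rw [pd_sub h12 (differentiableAt_ite _ (hd j i)),
      pd_add (differentiableAt_ite _ (hd i m)) (differentiableAt_ite _ (hd j m)),
      pd_ite, pd_ite, pd_ite]
  simp only [h, Finset.sum_add_distrib, Finset.sum_sub_distrib, Finset.sum_ite_eq', Finset.mem_univ,
    if_true]
  congr 1
  congr 1
  · split_ifs
    · exact sum_pd_conicKernel hx hκ hhom i
    · simp
  · split_ifs
    · exact sum_pd_conicKernel hx hκ hhom j
    · simp

/-- **`Σ_i ∂_i (K_κ)^{ij}_k = 0` on `ℝ³ ∖ {0}`**: the symmetric divergence of the kernel of `T_c` is supported at the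
origin (where it is `δ^j_k δ₀`, Lemma 2.5 (T_c2)), for `κ` of class `C²` and `0`-homogeneous off the origin; the kernel
is taken in the first-order form of `sum_pd_conicKernelT`. Proof as in Remark 2.6: the `δ^j_k`-term is
`Σ_i ∂_i(κ zⁱ/|z|³) = 0`, and `Σ_i ∂_i ∂_k (κ zʲzⁱ/|z|³) = ∂_k Σ_i ∂_i (κ zʲzⁱ/|z|³) = ∂_k (κ zʲ/|z|³)` (commuting mixed
partials, `sum_pd_conicKernel` on a neighbourhood) cancels the `δ^i_k`-term.
[cite: MaoOhTao2023, Lemma 2.5 (T_c2) and Remark 2.6] -/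
theorem sum_pd_conicKernelT_div (hx : x ≠ 0) (hκ : ∀ y : E3, y ≠ 0 → ContDiffAt ℝ 2 κ y)
    (hhom : ∀ y : E3, y ≠ 0 → ∀ t : ℝ, 0 < t → κ (t • y) = κ y) (j k : Fin 3) :
    ∑ i, pd i (fun y : E3 ↦
        (if j = k then κ y * (y i * (‖y‖ ^ 3)⁻¹) else 0)
          + (if i = k then κ y * (y j * (‖y‖ ^ 3)⁻¹) else 0)
          - pd k (fun z : E3 ↦ κ z * (z j * (z i * (‖z‖ ^ 3)⁻¹))) y) x = 0 := by
  have hκd : DifferentiableAt ℝ κ x := (hκ x hx).differentiableAt (by simp)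
  have hF2 : ∀ i, ContDiffAt ℝ 2 (fun z : E3 ↦ κ z * (z j * (z i * (‖z‖ ^ 3)⁻¹))) x := fun i ↦
    contDiffAt_conicMonomial (hκ x hx) hx j i
  have hd1 : ∀ i, DifferentiableAt ℝ (fun y : E3 ↦ κ y * (y i * (‖y‖ ^ 3)⁻¹)) x := fun i ↦
    hκd.mul ((EuclideanSpace.proj (𝕜 := ℝ) i).differentiableAt.mul (differentiableAt_inv_norm_cube hx))
  -- differentiate term by term
  have h : ∀ i, pd i (fun y : E3 ↦
        (if j = k then κ y * (y i * (‖y‖ ^ 3)⁻¹) else 0)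
          + (if i = k then κ y * (y j * (‖y‖ ^ 3)⁻¹) else 0)
          - pd k (fun z : E3 ↦ κ z * (z j * (z i * (‖z‖ ^ 3)⁻¹))) y) x =
      (if j = k then pd i (fun y : E3 ↦ κ y * (y i * (‖y‖ ^ 3)⁻¹)) x else 0)
        + (if i = k then pd i (fun y : E3 ↦ κ y * (y j * (‖y‖ ^ 3)⁻¹)) x else 0)
        - pd k (pd i (fun z : E3 ↦ κ z * (z j * (z i * (‖z‖ ^ 3)⁻¹)))) x := by
    intro i
    have h12 : DifferentiableAt ℝ (fun y : E3 ↦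
        (if j = k then κ y * (y i * (‖y‖ ^ 3)⁻¹) else 0)
          + (if i = k then κ y * (y j * (‖y‖ ^ 3)⁻¹) else 0)) x :=
      (differentiableAt_ite _ (hd1 i)).add (differentiableAt_ite _ (hd1 j))
    rw [pd_sub h12 (differentiableAt_pd (hF2 i) k),
      pd_add (differentiableAt_ite _ (hd1 i)) (differentiableAt_ite _ (hd1 j)), pd_ite, pd_ite,
      pd_pd_comm (hF2 i) i k]
  simp only [h, Finset.sum_add_distrib, Finset.sum_sub_distrib, Finset.sum_ite_eq', Finset.mem_univ,
    if_true]
  -- `Σ_i ∂_k ∂_i F_{ji} = ∂_k Σ_i ∂_i F_{ji} = ∂_k (κ zʲ/|z|³)` near `x`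
  have hne : ∀ᶠ y in 𝓝 x, y ≠ 0 := isOpen_ne.mem_nhds hx
  have heq : (fun y : E3 ↦ ∑ i, pd i (fun z : E3 ↦ κ z * (z j * (z i * (‖z‖ ^ 3)⁻¹))) y)
      =ᶠ[𝓝 x] fun y ↦ κ y * (y j * (‖y‖ ^ 3)⁻¹) :=
    hne.mono fun y hy ↦ sum_pd_conicKernel hy ((hκ y hy).differentiableAt (by simp)) (hhom y hy) j
  have hsum : ∑ i, pd k (pd i (fun z : E3 ↦ κ z * (z j * (z i * (‖z‖ ^ 3)⁻¹)))) x =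
      pd k (fun y : E3 ↦ κ y * (y j * (‖y‖ ^ 3)⁻¹)) x := by
    rw [← pd_sum _ (fun i y ↦ pd i (fun z : E3 ↦ κ z * (z j * (z i * (‖z‖ ^ 3)⁻¹))) y)
      fun i _ ↦ differentiableAt_pd (hF2 i) i, pd, pd, heq.fderiv_eq]
  rw [hsum]
  split_ifs with hjk
  · rw [sum_pd_mul_coord_inv_norm_cube hx hκd (hhom x hx)]
    ring
  · ring

end TKernel

end MaoOhTao

end Literature.Geometry.Lorentzian

end
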